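import Mathlib
import Summits.ValiantsHypothesis.ValiantsHypothesis.Theorems.FifoMatchingXcDivisionZmixFace
import Summits.ValiantsHypothesis.ValiantsHypothesis.Theorems.FifoMatchingNFPolytopeQueueGridCorProjection
import HarnessLib

/-!
# ★★★ `Q(Z_mix)` IS DECIDED AT THE ROUTE RATE: `xc(COR(K_n) + Z_mix(n)) > 2^((log₂ n + c)^c)` eventually, for every `c`

Theorems-side port (director-valiant g13 R232 (a) / R233 (b) / R234 (d); port hand val-port-2 g1; `--supports
stmt-ValiantsHypothesis-21181 --as helper`) of §10d of val-idea-7 g9's crux workfile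
`Cruxes/NNLinearDegreeCofactorHard/Lines/xc_division.lean` rev 4.1 (`zmixCorHard_holds`, critic val-idea-crit-3 g3 by-name
PASS 12:00Z), verbatim body with the line's threshold `T c n` UNFOLDED to `2 ^ ((Nat.log 2 n + c) ^ c)` and the line-local
`Prop` `ZmixCorHard` stated UNFOLDED (crit-3 porter note (i)): from PROP E (`two_pow_le_of_cor_add_zmix`, sibling file) with
`m = ⌊√n⌋ − 1`, the threshold arithmetic `T_pow_four_le` and c1's `QueueGridFace.growth_eventually`.

* `T_pow_four_le` — `n < h⁴ ⇒ (T c n)⁴ ≤ T (4^(c+1)+c+1) h`.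
* ★★★ `zmixCorHard` — the parked instance `Q(Z_mix)` of COR-MINKOWSKI, DECIDED·TRUE at the route rate.
* `two_pow_sqrt_le_of_cor_add_zmix` — the explicit bound `xc(COR(K_n) + Z_mix(n)) ≥ 2^{(⌊√n⌋−1)/2}` for `⌊√n⌋ ≥ 5`.

HONEST FRAMING (R233 (b), verbatim intent): «decides ONE passenger (`Z_mix`) at rate `2^{(⌊√n⌋−1)/2}`; COR-MINKOWSKI `∀ Q`
= LAW, OPEN; not 21181».  `ZmixCorExpHard` (rate `2^{c·n}`), the LAW `CorMinkowskiHard`, stmt-21181 `NNDivisionHard`,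
`NNNotVP` and `VP ≠ VNP` are all OPEN / NOT proved; nothing here is a summit statement.
-/

set_option autoImplicit false

-- the mandated summit-side namespace repeats a component by design (single-problem summit)
set_option linter.dupNamespace false

noncomputable section

open Matrix Finset
open scoped Pointwise

namespace Summit.ValiantsHypothesis.ValiantsHypothesis.Theorems.FifoMatching

namespace XcDivision

open Literature.Barriers.PneNP (HasEFOfSize)
open Literature.Combinatorics.Optimization (corPolytopeGraph)
open Summit.ValiantsHypothesis.ValiantsHypothesis.Theorems.FifoMatching.QueueGridFace (growth_eventually)

/-- threshold arithmetic: if `n < h⁴` then `(T c n)⁴ ≤ T (4^(c+1) + c + 1) h`, `T c n = 2^((log₂ n + c)^c)`. -/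
theorem T_pow_four_le {c n h : ℕ} (hn : n ≠ 0) (hh : n < h ^ 4) :
    (2 ^ ((Nat.log 2 n + c) ^ c)) ^ 4 ≤ 2 ^ ((Nat.log 2 h + (4 ^ (c + 1) + c + 1)) ^ (4 ^ (c + 1) + c + 1)) := by
  have h2 : 1 < 2 := by norm_num
  have hlog : Nat.log 2 n < 4 * (Nat.log 2 h + 1) := by
    rw [Nat.log_lt_iff_lt_pow h2 hn]
    calc n < h ^ 4 := hh
      _ ≤ (2 ^ (Nat.log 2 h + 1)) ^ 4 := Nat.pow_le_pow_left (Nat.lt_pow_succ_log_self h2 h).le 4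
      _ = 2 ^ (4 * (Nat.log 2 h + 1)) := by rw [← pow_mul, mul_comm]
  obtain ⟨p, hp⟩ : ∃ p, p = 4 ^ (c + 1) := ⟨_, rfl⟩
  obtain ⟨L, hL⟩ : ∃ L, L = Nat.log 2 h := ⟨_, rfl⟩
  rw [← hL] at hlog
  have hp4 : p = 4 * 4 ^ c := by rw [hp, pow_succ, mul_comm]
  have hbase : Nat.log 2 n + c ≤ 4 * (L + c + 1) := by omega
  have h1 : (Nat.log 2 n + c) ^ c ≤ 4 ^ c * (L + c + 1) ^ c := by
    calc (Nat.log 2 n + c) ^ c ≤ (4 * (L + c + 1)) ^ c := Nat.pow_le_pow_left hbase c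
      _ = 4 ^ c * (L + c + 1) ^ c := mul_pow 4 _ c
  have h3 : 4 * (Nat.log 2 n + c) ^ c ≤ (L + (p + c + 1)) ^ (p + c + 1) := by
    calc 4 * (Nat.log 2 n + c) ^ c ≤ 4 * (4 ^ c * (L + c + 1) ^ c) := Nat.mul_le_mul_left 4 h1
      _ = p * (L + c + 1) ^ c := by rw [hp4]; ring
      _ ≤ (L + (p + c + 1)) * (L + (p + c + 1)) ^ c :=
          Nat.mul_le_mul (by omega) (Nat.pow_le_pow_left (by omega) c)
      _ = (L + (p + c + 1)) ^ (c + 1) := by rw [pow_succ]; ring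
      _ ≤ (L + (p + c + 1)) ^ (p + c + 1) := Nat.pow_le_pow_right (by omega) (by omega)
  rw [hL] at h3
  rw [← hp]
  calc (2 ^ ((Nat.log 2 n + c) ^ c)) ^ 4 = 2 ^ (4 * (Nat.log 2 n + c) ^ c) := by rw [← pow_mul, mul_comm]
    _ ≤ 2 ^ ((Nat.log 2 h + (p + c + 1)) ^ (p + c + 1)) := Nat.pow_le_pow_right (by norm_num) h3

/-- ★★★ **`Q(Z_mix)` IS DECIDED AT THE ROUTE RATE: `ZmixCorHard` holds** — `xc(COR(K_n) + Z_mix(n)) > T c n` eventually, for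
every `c` (`2^{(⌊√n⌋−1)/2} ≤ r` by `two_pow_le_of_cor_add_zmix` with `m = ⌊√n⌋ − 1`; `T c n ≤ (T c n)⁴ ≤ T c' m` by
`T_pow_four_le` since `n < m⁴`; `T c' m < 2^{m/4}` eventually by c1's `growth_eventually`).  The parked instance of the card's
open problem is thereby settled in the direction the LAW predicts.  HONEST FRAMING (director-valiant g13 R233 (b)): this
decides ONE passenger (`Z_mix`) at rate `2^{(⌊√n⌋−1)/2}`; COR-MINKOWSKI `∀ Q` = LAW, OPEN; NOT stmt-21181 `NNDivisionHard`
(OPEN); `VP ≠ VNP` NOT proved.  Statement = the line's `ZmixCorHard` with `T c n` unfolded (no `Prop` definition). -/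
theorem zmixCorHard :
    ∀ c : ℕ, ∃ n₀ : ℕ, ∀ n ≥ n₀, ∀ r : ℕ,
      HasEFOfSize (corPolytopeGraph (⊤ : SimpleGraph (Fin n)) + Zmix n) r → 2 ^ ((Nat.log 2 n + c) ^ c) < r := by
  intro c
  obtain ⟨r₀, hr₀2, hgrowth⟩ := growth_eventually (4 ^ (c + 1) + c + 1) (c := (1 / 2 : ℝ)) (by norm_num)
  refine ⟨(max r₀ 4 + 2) ^ 2, fun n hn r hEF => ?_⟩
  -- `s = ⌊√n⌋`, `m = s - 1`
  obtain ⟨s, hs⟩ : ∃ s, s = Nat.sqrt n := ⟨_, rfl⟩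
  have hsR : max r₀ 4 + 2 ≤ s := by rw [hs]; exact Nat.le_sqrt'.2 hn
  have hss : s * s ≤ n := by rw [hs]; exact Nat.sqrt_le n
  have hns : n < (s + 1) * (s + 1) := by rw [hs]; exact Nat.lt_succ_sqrt n
  obtain ⟨m, hm⟩ : ∃ m, m = s - 1 := ⟨_, rfl⟩
  have hm1 : s = m + 1 := by omega
  have hm4 : 4 ≤ m := by
    have := le_max_right r₀ 4
    omega
  have hmr : r₀ ≤ m := by
    have := le_max_left r₀ 4
    omega
  rw [hm1] at hss hns
  have hmn : m + m * m ≤ n := by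
    have : m + m * m ≤ (m + 1) * (m + 1) := by nlinarith
    omega
  have h16 : 4 * 4 ≤ m * m := Nat.mul_le_mul hm4 hm4
  have hsm : (m + 1 + 1) * (m + 1 + 1) ≤ m ^ 4 :=
    calc (m + 1 + 1) * (m + 1 + 1) = (m + 2) * (m + 2) := by ring
      _ ≤ (4 * m) * (4 * m) := Nat.mul_le_mul (by omega) (by omega)
      _ = 16 * (m * m) := by ring
      _ ≤ (m * m) * (m * m) := Nat.mul_le_mul_right _ h16
      _ = m ^ 4 := by ring
  have hn4 : n < m ^ 4 := lt_of_lt_of_le hns hsm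
  have hn0 : n ≠ 0 := by omega
  have hT := T_pow_four_le (c := c) hn0 hn4
  have hbound := two_pow_le_of_cor_add_zmix hm4 hmn hEF
  have hg := hgrowth m hmr
  have hmono : (2 : ℝ) ^ ((1 / 2 : ℝ) * ((m / 2 : ℕ) : ℝ)) ≤ (2 : ℝ) ^ ((m : ℝ) / 2) := by
    apply Real.rpow_le_rpow_of_exponent_le (by norm_num)
    have : ((m / 2 : ℕ) : ℝ) ≤ (m : ℝ) := by exact_mod_cast Nat.div_le_self m 2
    linarith
  have hT' : ((2 ^ ((Nat.log 2 m + (4 ^ (c + 1) + c + 1)) ^ (4 ^ (c + 1) + c + 1)) : ℕ) : ℝ) =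
      (2 : ℝ) ^ ((Nat.log 2 m + (4 ^ (c + 1) + c + 1)) ^ (4 ^ (c + 1) + c + 1)) := by
    push_cast; rfl
  have hpos : (0 : ℝ) ≤ 4 * (m : ℝ) ^ 4 := by positivity
  have hlt : ((2 ^ ((Nat.log 2 m + (4 ^ (c + 1) + c + 1)) ^ (4 ^ (c + 1) + c + 1)) : ℕ) : ℝ) < r := by
    rw [hT']; linarith
  have hlt' : 2 ^ ((Nat.log 2 m + (4 ^ (c + 1) + c + 1)) ^ (4 ^ (c + 1) + c + 1)) < r := by exact_mod_cast hlt
  calc 2 ^ ((Nat.log 2 n + c) ^ c) ≤ (2 ^ ((Nat.log 2 n + c) ^ c)) ^ 4 := Nat.le_self_pow (by norm_num) _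
    _ ≤ 2 ^ ((Nat.log 2 m + (4 ^ (c + 1) + c + 1)) ^ (4 ^ (c + 1) + c + 1)) := hT
    _ < r := hlt'

/-- the same, as the explicit lower bound `xc(COR(K_n) + Z_mix(n)) ≥ 2^{(⌊√n⌋ − 1)/2}` for `⌊√n⌋ ≥ 5`. -/
theorem two_pow_sqrt_le_of_cor_add_zmix {n r : ℕ} (hn : 5 ≤ Nat.sqrt n)
    (h : HasEFOfSize (corPolytopeGraph (⊤ : SimpleGraph (Fin n)) + Zmix n) r) :
    (2 : ℝ) ^ (((Nat.sqrt n - 1 : ℕ) : ℝ) / 2) ≤ r := by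
  refine two_pow_le_of_cor_add_zmix (m := Nat.sqrt n - 1) (by omega) ?_ h
  have hss : Nat.sqrt n * Nat.sqrt n ≤ n := Nat.sqrt_le n
  obtain ⟨m, hm⟩ : ∃ m, m = Nat.sqrt n - 1 := ⟨_, rfl⟩
  have hm1 : Nat.sqrt n = m + 1 := by omega
  rw [← hm]; rw [hm1] at hss
  have : m + m * m ≤ (m + 1) * (m + 1) := by nlinarith
  omega

end XcDivision

end Summit.ValiantsHypothesis.ValiantsHypothesis.Theorems.FifoMatching

end
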